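import Mathlib
import Summits.MatrixMultiplication.MatrixMultiplication.Theorems.FourierTwoFamiliesModPPrimeLogDecayStubThetaRectangleCover
import Summits.MatrixMultiplication.MatrixMultiplication.Theorems.FourierTwoFamiliesModPPrimeLogDecayStubIntervalCoverage

/-!
# The theta body on interval frozen sets (stub `stub_thetaIntervalBound`)

Crux `stmt-MatrixMultiplication-14310` (`FourierTwoFamiliesModP.PrimeLogDecay`), line
`fixed-delta-theta-certificate`; closes the registered milestone stub `stub_thetaIntervalBound` — the bet
`stub_thetaLogBoundNoCert` restricted to INTERVAL frozen sets, at wall order.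

Setting: `X₀ = {0, …, L − 1} ⊆ ZMod p` (as residues), `2 ≤ s`, `s² ≤ L`, `3L ≤ p`; a kernel `B` on block pairs
`v = (v.1, v.2) ∈ Finset (ZMod p) × Finset (ZMod p)` that is symmetric, PSD, entrywise nonnegative, of trace `1`,
and supported on admissible (`|v.1| = |v.2| = s`, direct, `v.1 − v.2 ⊆ X₀`) equal-or-compatible pairs.  Then
`⌊s²/2⌋² · Σ_{v,w} B v w ≤ p · (L + ⌊s²/2⌋)`: value `≲ (4L + 2s²) p / s⁴`, the wall order `6p/s²` at `L ≍ s²`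
and below the log threshold `p/(s (log s)^c)` whenever `L ≤ s³/(5 (log s)^c)`.  (Numerically, over all
admissible shapes for `s = 2, 3, 4`, the single-rectangle bound is within a factor `1.9` of the wall.)

Proof: the landed translated-rectangle clique cover `RectangleCover.stub_thetaRectangleCover` with the rectangle
`P = [b, L)`, `Q = [0, b)`, `b = ⌊s²/2⌋` (`P − Q ⊆ X₀`, `ico_sub_range_subset`), `m = b`, `M = L + b`; the
coverage bounds are the landed `IntervalCoverage.stub_intervalCoverage`; `|ZMod p| = p` and trace `1` finish.
Translation invariance and diagonal dominance of `B` are not needed.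
-/

namespace Summit.MatrixMultiplication.MatrixMultiplication.Theorems.PrimeLogDecayTheta.IntervalBound

open scoped BigOperators Pointwise
open Summit.MatrixMultiplication.MatrixMultiplication.Theorems.PrimeLogDecayTheta

/-- The interval rectangle: `[b, L) − [0, b) ⊆ [0, L)` as residues of `ZMod p`. -/
theorem ico_sub_range_subset (p b L : ℕ) :
    (Finset.Ico b L).image (Nat.cast : ℕ → ZMod p) - (Finset.range b).image (Nat.cast : ℕ → ZMod p)
      ⊆ (Finset.range L).image (Nat.cast : ℕ → ZMod p) := by
  intro x hx
  rw [Finset.mem_sub] at hx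
  obtain ⟨u, hu, v, hv, rfl⟩ := hx
  rw [Finset.mem_image] at hu hv ⊢
  obtain ⟨i, hi, rfl⟩ := hu
  obtain ⟨j, hj, rfl⟩ := hv
  rw [Finset.mem_Ico] at hi
  rw [Finset.mem_range] at hj
  refine ⟨i - j, Finset.mem_range.2 (by omega), ?_⟩
  rw [Nat.cast_sub (by omega)]

/-- **Registered milestone stub `stub_thetaIntervalBound`** (crux stmt-MatrixMultiplication-14310, line
fixed-delta-theta-certificate): for `2 ≤ s`, `s² ≤ L`, `3L ≤ p` and the interval frozen set
`X₀ = {0, …, L−1} ⊆ ZMod p`, every symmetric PSD entrywise-nonnegative trace-one kernel supported on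
admissible-compatible pairs satisfies `⌊s²/2⌋² · Σ_{v,w} B v w ≤ p · (L + ⌊s²/2⌋)`. -/
theorem stub_thetaIntervalBound :
    ∀ (p : ℕ) [Fact p.Prime] (s L : ℕ), 2 ≤ s → s ^ 2 ≤ L → 3 * L ≤ p →
      ∀ B : Finset (ZMod p) × Finset (ZMod p) → Finset (ZMod p) × Finset (ZMod p) → ℝ,
      (∀ v w, B v w = B w v) →
      (∀ x : Finset (ZMod p) × Finset (ZMod p) → ℝ, 0 ≤ ∑ v, ∑ w, x v * B v w * x w) →
      (∀ v w, 0 ≤ B v w) →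
      (∀ v w : Finset (ZMod p) × Finset (ZMod p), B v w ≠ 0 →
        (v.1.card = s ∧ v.2.card = s ∧
          (∀ a ∈ v.1, ∀ a' ∈ v.1, ∀ b ∈ v.2, ∀ b' ∈ v.2, (a - a') + (b - b') = 0 → a = a' ∧ b = b') ∧
          v.1 - v.2 ⊆ (Finset.range L).image (Nat.cast : ℕ → ZMod p)) ∧
        (w.1.card = s ∧ w.2.card = s ∧
          (∀ a ∈ w.1, ∀ a' ∈ w.1, ∀ b ∈ w.2, ∀ b' ∈ w.2, (a - a') + (b - b') = 0 → a = a' ∧ b = b') ∧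
          w.1 - w.2 ⊆ (Finset.range L).image (Nat.cast : ℕ → ZMod p)) ∧
        (v = w ∨ (Disjoint (v.1 - w.2) ((Finset.range L).image (Nat.cast : ℕ → ZMod p)) ∧
          Disjoint (w.1 - v.2) ((Finset.range L).image (Nat.cast : ℕ → ZMod p))))) →
      ∑ v, B v v = 1 →
      ((s ^ 2 / 2 : ℕ) : ℝ) ^ 2 * ∑ v, ∑ w, B v w ≤ (p : ℝ) * ((L : ℝ) + ((s ^ 2 / 2 : ℕ) : ℝ)) := by
  intro p _ s L hs hsL hLp B hsymm hpsd hnn hsupp htr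
  have hm : 0 < s ^ 2 / 2 := by
    have h4 : 4 ≤ s ^ 2 := by nlinarith
    omega
  have key := RectangleCover.stub_thetaRectangleCover (ZMod p)
    ((Finset.range L).image (Nat.cast : ℕ → ZMod p))
    ((Finset.Ico (s ^ 2 / 2) L).image (Nat.cast : ℕ → ZMod p))
    ((Finset.range (s ^ 2 / 2)).image (Nat.cast : ℕ → ZMod p)) B (s ^ 2 / 2) (L + s ^ 2 / 2) hm
    (ico_sub_range_subset p _ _) hsymm hpsd hnn (fun v w h => (hsupp v w h).2.2)
    (fun v hv => (IntervalCoverage.stub_intervalCoverage p s L hs hsL hLp v.1 v.2 (hsupp v v hv).1.1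
      (hsupp v v hv).1.2.1 (hsupp v v hv).1.2.2.1 (hsupp v v hv).1.2.2.2).1)
    (fun v hv => (IntervalCoverage.stub_intervalCoverage p s L hs hsL hLp v.1 v.2 (hsupp v v hv).1.1
      (hsupp v v hv).1.2.1 (hsupp v v hv).1.2.2.1 (hsupp v v hv).1.2.2.2).2)
  rw [htr, ZMod.card p, mul_one] at key
  have e : ((L + s ^ 2 / 2 : ℕ) : ℝ) * (p : ℝ) = (p : ℝ) * ((L : ℝ) + ((s ^ 2 / 2 : ℕ) : ℝ)) := by
    push_cast
    ring
  linarith [key, e]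

end Summit.MatrixMultiplication.MatrixMultiplication.Theorems.PrimeLogDecayTheta.IntervalBound
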